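import Mathlib.RingTheory.Localization.AtPrime.Basic
import Mathlib.RingTheory.Regular.RegularSequence
import Mathlib.RingTheory.KrullDimension.Basic
import Mathlib.RingTheory.Noetherian.Basic
import Mathlib.RingTheory.LocalRing.Basic
import Mathlib.Algebra.CharP.Defs
import HarnessLib

/-!
# Cohen–Macaulay F-injectivity localizes (Hashimoto 2010, Cor. 4.7) — named fact

Topic: `Literature/RingTheory/TightClosure` (F-singularities; companion of `HashimotoGradedCMFI.lean` (Cor. 5.2, res-D-pv-019),
`CMFIDeforms.lean`, `FInjectiveDeformation.lean`).
M. Hashimoto, *F-pure homomorphisms, strong F-regularity, and F-injectivity*, Comm. Algebra 38 (2010) 4569–4596 = arXiv:0908.2703;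
held text `paper:arxiv-0908.2703`, p0017 lines 113–116 (§4 «Cohen–Macaulay F-injective property»):

  *«Corollary 4.7. Let `(R, 𝔪)` be a noetherian local CMFI ring of characteristic `p`. Then for any prime ideal `P` of `R`, `R_P` is
  CMFI.»*

(Proof in print: pass to an `F`-finite faithfully flat CMFI local `R`-algebra `R'` (Lemma 4.6), use openness of the CMFI locus of `R'`
(Lemma 4.5) and descent along `R_P → R'_Q` (Lemma 4.3).) «CMFI» for a Noetherian local ring = Cohen–Macaulay and `F`-injective (§4, p0016);
by Lemma 4.1 of the same paper, for a Cohen–Macaulay local ring this is «every parameter ideal is Frobenius closed» — the rendering used in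
the tree (Mathlib has neither predicate): every system of parameters (`d = dim` elements generating an ideal with maximal radical) is a
weakly regular sequence (Cohen–Macaulay, Matsumura Thm. 17.4 (iii)) AND every such parameter ideal is Frobenius closed for the exponent base `p`,
exactly the token text of `HashimotoGradedCMFI.lean` and of the `FInjectiveMacaulayfication` crux files (`SliceableCentre.CMCl` ∧ `FCl`).

* `Hashimoto2010_cmfiLocalizes` — the named fact; users take `(h : Hashimoto2010_cmfiLocalizes)`.

## References

* [Hashimoto2010] M. Hashimoto, Comm. Algebra 38 (2010), Cor. 4.7 (arXiv:0908.2703, p. 17), Lemma 4.1 (p. 16).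
-/

namespace Literature.RingTheory.TightClosure

universe u

/-- NAMED FACT — **Hashimoto 2010, Cor. 4.7 (CMFI localizes)**: *«Let `(R, 𝔪)` be a noetherian local CMFI ring of characteristic `p`.
Then for any prime ideal `P` of `R`, `R_P` is CMFI.»* Rendering: `R` a Noetherian local ring of prime characteristic `p`; CMFI at a local
ring `L` := (every system of parameters of `L` — `d = dim L` elements generating an ideal with maximal radical — is a weakly regular sequence)
∧ (every such parameter ideal is Frobenius closed for the exponent base `p`) (Lemma 4.1 of the same paper); conclusion at
`Localization.AtPrime P` for every prime `P`.
-- TODO(general form): the F-pure / strongly F-regular companions (Cor. 4.4–4.6 context) are not typed.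
[cite: Hashimoto2010, Cor. 4.7; Lemma 4.1] -/
def Hashimoto2010_cmfiLocalizes : Prop :=
  ∀ (p : ℕ) [Fact p.Prime] (R : Type u) [CommRing R] [IsNoetherianRing R] [IsLocalRing R] [CharP R p],
    ((∀ d : ℕ, ringKrullDim R = d → ∀ s : Fin d → R, (Ideal.span (Set.range s)).radical.IsMaximal →
        RingTheory.Sequence.IsWeaklyRegular R (List.ofFn s)) ∧
      (∀ d : ℕ, ringKrullDim R = d → ∀ s : Fin d → R, (Ideal.span (Set.range s)).radical.IsMaximal →
        ∀ y : R, (∃ e : ℕ, y ^ p ^ e ∈ Ideal.span ((fun z : R => z ^ p ^ e) '' (Ideal.span (Set.range s) : Set R))) →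
          y ∈ Ideal.span (Set.range s))) →
    ∀ (P : Ideal R) [P.IsPrime],
      (∀ d : ℕ, ringKrullDim (Localization.AtPrime P) = d →
          ∀ s : Fin d → Localization.AtPrime P, (Ideal.span (Set.range s)).radical.IsMaximal →
            RingTheory.Sequence.IsWeaklyRegular (Localization.AtPrime P) (List.ofFn s)) ∧
        (∀ d : ℕ, ringKrullDim (Localization.AtPrime P) = d →
          ∀ s : Fin d → Localization.AtPrime P, (Ideal.span (Set.range s)).radical.IsMaximal →
            ∀ y : Localization.AtPrime P,
              (∃ e : ℕ, y ^ p ^ e ∈ Ideal.span ((fun z : Localization.AtPrime P => z ^ p ^ e) ''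
                (Ideal.span (Set.range s) : Set (Localization.AtPrime P)))) →
              y ∈ Ideal.span (Set.range s))

end Literature.RingTheory.TightClosure
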